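import Mathlib
import HarnessLib

/-!
# `ZagierDilogarithmConjecture` (stmt-KontsevichZagierPeriods-10550) — line
`kummer-clausen-linearisation` (reshape c4, "the cyclotomic sector, exactly"), stub
`stub_oddFourierInversion`

**Fourier inversion for odd functions on `(ℤ/N)ˣ`.** Let `N ≥ 1` and let `f : (ℤ/N)ˣ → ℂ` be ODD,
`f(−u) = −f(u)`. If every pairing `Σ_u f(u) χ(u)` with an ODD Dirichlet character `χ mod N`
vanishes, then `f = 0`.

Proof.
* The pairing with an EVEN character vanishes automatically: substituting `u ↦ −u`,
  `Σ_u f(u) χ(u) = Σ_u f(−u) χ(−u) = −Σ_u f(u) χ(u)`, and `S = −S` forces `S = 0` in `ℂ`.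
* Every character is even or odd (`DirichletCharacter.even_or_odd`), so ALL pairings vanish.
* Orthogonality (`DirichletCharacter.sum_char_inv_mul_char_eq`:
  `Σ_χ χ(v⁻¹) χ(u) = φ(N) · [u = v]`) gives
  `0 = Σ_χ χ(v⁻¹) · Σ_u f(u) χ(u) = Σ_u f(u) · Σ_χ χ(v⁻¹) χ(u) = φ(N) · f(v)`,
  and `φ(N) ≠ 0`.
Mathlib only; sorry-free; axioms ⊆ {propext, Classical.choice, Quot.sound}.
-/

noncomputable section

open scoped BigOperators

namespace Summit.KontsevichZagierPeriods.HyperbolicBloch.ZagierDilogarithmCyclotomic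

namespace OddFourierInversion

/-- The pairing of an odd function on `(ℤ/N)ˣ` with an EVEN Dirichlet character vanishes:
substituting `u ↦ −u` gives `S = −S`. [folklore] -/
theorem sum_mul_even_eq_zero {N : ℕ} [NeZero N] (f : (ZMod N)ˣ → ℂ)
    (hodd : ∀ u, f (-u) = -f u) (χ : DirichletCharacter ℂ N) (hχ : χ.Even) :
    ∑ u : (ZMod N)ˣ, f u * χ u = 0 := by
  have hS : ∑ u : (ZMod N)ˣ, f u * χ u = -∑ u : (ZMod N)ˣ, f u * χ u := by
    calc ∑ u : (ZMod N)ˣ, f u * χ u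
        = ∑ u : (ZMod N)ˣ, f (-u) * χ (↑(-u) : ZMod N) :=
          (Fintype.sum_equiv (Equiv.neg (ZMod N)ˣ) _ _ fun u ↦ rfl).symm
      _ = -∑ u : (ZMod N)ˣ, f u * χ u := by
          rw [← Finset.sum_neg_distrib]
          refine Finset.sum_congr rfl fun u _ ↦ ?_
          rw [hodd, Units.val_neg, hχ.eval_neg, neg_mul]
  exact CharZero.eq_neg_self_iff.mp hS

/-- For an odd function on `(ℤ/N)ˣ` whose pairings with all odd characters vanish, the pairing
with EVERY Dirichlet character vanishes (each character is even or odd). [folklore] -/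
theorem sum_mul_char_eq_zero {N : ℕ} [NeZero N] (f : (ZMod N)ˣ → ℂ)
    (hodd : ∀ u, f (-u) = -f u)
    (hpair : ∀ χ : DirichletCharacter ℂ N, χ.Odd → ∑ u : (ZMod N)ˣ, f u * χ u = 0)
    (χ : DirichletCharacter ℂ N) : ∑ u : (ZMod N)ˣ, f u * χ u = 0 := by
  rcases χ.even_or_odd with he | ho
  · exact sum_mul_even_eq_zero f hodd χ he
  · exact hpair χ ho

/-- Character orthogonality, summed against `f`: for a unit `v`,
`Σ_χ χ(v⁻¹) · Σ_u f(u) χ(u) = φ(N) · f(v)`. [folklore] -/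
theorem sum_char_inv_mul_pairing {N : ℕ} [NeZero N] (f : (ZMod N)ˣ → ℂ) (v : (ZMod N)ˣ) :
    ∑ χ : DirichletCharacter ℂ N, χ (v : ZMod N)⁻¹ * ∑ u : (ZMod N)ˣ, f u * χ u =
      (N.totient : ℂ) * f v := by
  calc ∑ χ : DirichletCharacter ℂ N, χ (v : ZMod N)⁻¹ * ∑ u : (ZMod N)ˣ, f u * χ u
      = ∑ χ : DirichletCharacter ℂ N, ∑ u : (ZMod N)ˣ, f u * (χ (v : ZMod N)⁻¹ * χ u) := by
        refine Finset.sum_congr rfl fun χ _ ↦ ?_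
        rw [Finset.mul_sum]
        refine Finset.sum_congr rfl fun u _ ↦ ?_
        ring
    _ = ∑ u : (ZMod N)ˣ, ∑ χ : DirichletCharacter ℂ N, f u * (χ (v : ZMod N)⁻¹ * χ u) :=
        Finset.sum_comm
    _ = ∑ u : (ZMod N)ˣ, f u * ∑ χ : DirichletCharacter ℂ N, χ (v : ZMod N)⁻¹ * χ u := by
        refine Finset.sum_congr rfl fun u _ ↦ ?_
        rw [Finset.mul_sum]
    _ = ∑ u : (ZMod N)ˣ, f u * (if (v : ZMod N) = u then (N.totient : ℂ) else 0) := by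
        refine Finset.sum_congr rfl fun u _ ↦ ?_
        rw [DirichletCharacter.sum_char_inv_mul_char_eq ℂ (Units.isUnit v) (u : ZMod N)]
    _ = ∑ u : (ZMod N)ˣ, (if v = u then (N.totient : ℂ) * f u else 0) := by
        refine Finset.sum_congr rfl fun u _ ↦ ?_
        by_cases h : v = u
        · rw [if_pos h, if_pos (congrArg Units.val h), mul_comm]
        · rw [if_neg h, if_neg (fun h' ↦ h (Units.val_injective h')), mul_zero]
    _ = (N.totient : ℂ) * f v := by
        rw [Finset.sum_ite_eq]
        simp

end OddFourierInversion

open OddFourierInversion in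
/-- **Fourier inversion for odd functions on `(ℤ/N)ˣ`.** An odd function `f : (ℤ/N)ˣ → ℂ`
all of whose pairings `Σ_u f(u) χ(u)` with ODD Dirichlet characters vanish is zero: the pairings
with even characters vanish by oddness (`u ↦ −u`), so all pairings vanish, and character
orthogonality `Σ_χ χ(v⁻¹) χ(u) = φ(N) · [u = v]` gives `φ(N) · f(v) = 0`. [folklore] -/
theorem stub_oddFourierInversion :
    ∀ (N : ℕ) [NeZero N] (f : (ZMod N)ˣ → ℂ), (∀ u, f (-u) = -f u) →
      (∀ χ : DirichletCharacter ℂ N, χ.Odd → ∑ u : (ZMod N)ˣ, f u * χ u = 0) → ∀ u, f u = 0 := by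
  intro N _ f hodd hpair v
  have key := sum_char_inv_mul_pairing f v
  have hzero : ∑ χ : DirichletCharacter ℂ N, χ (v : ZMod N)⁻¹ * ∑ u : (ZMod N)ˣ, f u * χ u = 0 :=
    Finset.sum_eq_zero fun χ _ ↦ by rw [sum_mul_char_eq_zero f hodd hpair χ, mul_zero]
  rw [hzero] at key
  have htot : (N.totient : ℂ) ≠ 0 := by
    exact_mod_cast (Nat.totient_pos.mpr (NeZero.pos N)).ne'
  exact (mul_eq_zero.mp key.symm).resolve_left htot

end Summit.KontsevichZagierPeriods.HyperbolicBloch.ZagierDilogarithmCyclotomic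

end
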